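import Summits.AnomalousDissipation.AnomalousDissipation.Theorems.MomentParityQuarticGateLambdaPositivity

/-!
# Stability of strict positivity and the far-atom moment identity (torus-free helpers for the
order-4 surgery `stub_surgery` of `MomentParity.QuarticGate`, line `recession-cone`,
stmt-AnomalousDissipation-11464)

In the Fialkow–Nie vocabulary (`Literature.MeasureTheory.Moments`):

* `exists_isStrictlyKPositive_nhds` — strict positivity of `L_y` on `𝒫₄(ℝⁿ)` is an OPEN condition
  on the finitely many entries `y_α`, `|α| ≤ 4` (Fialkow–Nie 2010, Lemma 2.3 = `eventually_kPositive`,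
  plus the midpoint trick `y' = ½(2y' − y) + ½ y`);
* `surgery_rieszFunctional` — the EXACT moment bookkeeping of the far-atom surgery: with
  `w = (Σ cₗ)/R⁴` and the modified sequence
  `y'_α = [y_α − 1_{|α|=2} R⁻² Σₗ cₗ xₗ^α] / (1 − w)` (`|α| ≥ 1`, `y'_0 = 1`),
  `(1 − w) L_{y'}(Q) + Σₗ cₗ/(2R⁴) (Q(R xₗ) + Q(−R xₗ)) = L_y(Q) + Σₗ cₗ Q₄(xₗ)` for `deg Q ≤ 4`;
* `exists_surgery_radius` — for `R → ∞` the modified sequence is uniformly close to `y` on `|α| ≤ 4`.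
-/

-- `Summit.<Summit>.<Problem>`: the duplicate namespace component is the tree's convention.
set_option linter.dupNamespace false

namespace Summit.AnomalousDissipation.AnomalousDissipation.Theorems.MomentParityQuarticGate

open scoped BigOperators Topology
open Filter MvPolynomial Literature.MeasureTheory.Moments

/-! ## Openness of strict positivity -/

/-- The coefficient vector on a set `T` of exponents containing the support reproduces the
polynomial. [folklore] -/
theorem sum_monomial_coeff_eq {n : ℕ} {T : Finset (Fin n →₀ ℕ)} {p : MvPolynomial (Fin n) ℝ}
    (hT : p.support ⊆ T) : ∑ α : ↥T, monomial α.1 (p.coeff α.1) = p := by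
  classical
  refine MvPolynomial.ext _ _ fun β => ?_
  rw [coeff_sum_monomial]
  split_ifs with hβ
  · rfl
  · exact (notMem_support_iff.mp fun h => hβ (hT h)).symm

/-- **Strict positivity is open** (Fialkow–Nie 2010, Lemma 2.3, in the form needed for the surgery):
if `L_y` is strictly positive on `𝒫₄(ℝⁿ)` then so is `L_{y'}` for every `y'` uniformly close to `y`
on the exponents of degree `≤ 4`. [cite: FialkowNie2010, Lemma 2.3] -/
theorem exists_isStrictlyKPositive_nhds :
    ∀ {n : ℕ} {y : (Fin n →₀ ℕ) → ℝ},
      Literature.MeasureTheory.Moments.IsStrictlyKPositive (Set.univ : Set (Fin n → ℝ)) 4 y →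
      ∃ ε : ℝ, 0 < ε ∧ ∀ y' : (Fin n →₀ ℕ) → ℝ,
        (∀ α : Fin n →₀ ℕ, α.degree ≤ 4 → |y' α - y α| ≤ ε) →
        Literature.MeasureTheory.Moments.IsStrictlyKPositive (Set.univ : Set (Fin n → ℝ)) 4 y' := by
  intro n y hy
  classical
  obtain ⟨T, hT⟩ := exists_finset_degree_le n 4
  have hTle : ∀ α ∈ T, (α.sum fun _ e => e) ≤ 4 := fun α hα => (hT α).mp hα
  have hTdeg : ∀ α : ↥T, α.1.degree ≤ 4 := fun α =>
    (finsupp_degree_eq_sum α.1).trans_le ((hT α.1).mp α.2)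
  -- dictionary between coefficient vectors on `T` and polynomials of degree `≤ 4`
  have hdeg : ∀ c : ↥T → ℝ, (∑ α : ↥T, monomial α.1 (c α)).totalDegree ≤ 4 := fun c =>
    totalDegree_sum_monomial_le hTle c
  have hriesz : ∀ (z : (Fin n →₀ ℕ) → ℝ) (c : ↥T → ℝ),
      rieszFunctional z (∑ α : ↥T, monomial α.1 (c α)) = c ⬝ᵥ fun α => z α.1 := fun z c => by
    unfold rieszFunctional
    exact riesz_sum_monomial c z
  have hsupp : ∀ p : MvPolynomial (Fin n) ℝ, p.totalDegree ≤ 4 → p.support ⊆ T := fun p hp β hβ =>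
    (hT β).mpr ((le_totalDegree hβ).trans hp)
  -- strict positivity on nonzero coefficient vectors of nonnegative polynomials
  have hstrict : ∀ c ∈ {c : ↥T → ℝ | ∀ x ∈ (Set.univ : Set (Fin n → ℝ)),
      0 ≤ c ⬝ᵥ fun α : ↥T => ∏ i, x i ^ (α.1 i)}, c ≠ 0 → 0 < c ⬝ᵥ fun α : ↥T => y α.1 := by
    intro c hc hc0
    rw [← hriesz y c]
    refine hy.2 _ (hdeg c) (fun x _ => ?_) ?_
    · rw [eval_sum_monomial]
      exact hc x (Set.mem_univ x)
    · by_contra hall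
      push Not at hall
      exact hc0 (eq_zero_of_sum_monomial_eq_zero (MvPolynomial.funext fun x => by
        rw [hall x (Set.mem_univ x), map_zero]))
  obtain ⟨δ, hδ, hball⟩ := Metric.eventually_nhds_iff.1 (eventually_kPositive hstrict)
  refine ⟨δ / 4, by positivity, fun y' hy' => ?_⟩
  -- the reflected sequence `2y' - y` is `δ`-close to `y`, hence positive (non-strictly)
  have hdist : dist ((2 : ℝ) • (fun α : ↥T => y' α.1) - fun α : ↥T => y α.1)
      (fun α : ↥T => y α.1) < δ := by
    refine lt_of_le_of_lt ((dist_pi_le_iff (by positivity : (0 : ℝ) ≤ δ / 2)).2 fun α => ?_)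
      (by linarith)
    rw [Real.dist_eq]
    have h := hy' α.1 (hTdeg α)
    have : ((2 : ℝ) • (fun α : ↥T => y' α.1) - fun α : ↥T => y α.1) α - y α.1 =
        2 * (y' α.1 - y α.1) := by
      simp only [Pi.sub_apply, Pi.smul_apply, smul_eq_mul]
      ring
    rw [this, abs_mul, abs_two]
    linarith
  have hpos2 := hball hdist
  refine isStrictlyKPositive_univ_of fun p hp hnn hex => ?_
  set c₀ : ↥T → ℝ := fun α => p.coeff α.1 with hc₀
  have hpc : ∑ α : ↥T, monomial α.1 (c₀ α) = p := sum_monomial_coeff_eq (hsupp p hp)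
  have hLy : 0 < c₀ ⬝ᵥ fun α : ↥T => y α.1 := by
    rw [← hriesz y c₀, hpc]
    obtain ⟨x, hx⟩ := hex
    exact hy.2 p hp (fun x _ => hnn x) ⟨x, Set.mem_univ x, hx⟩
  have hL2 : 0 ≤ c₀ ⬝ᵥ ((2 : ℝ) • (fun α : ↥T => y' α.1) - fun α : ↥T => y α.1) :=
    hpos2 c₀ fun x _ => by
      rw [← eval_sum_monomial, hpc]
      exact hnn x
  rw [← hpc, hriesz y' c₀]
  rw [dotProduct_sub, dotProduct_smul, smul_eq_mul] at hL2
  linarith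

/-! ## The far-atom moment identity -/

/-- Per-exponent form of the surgery bookkeeping: for `|α| ≤ 4`,
`(1 − w) y'_α + Σₗ cₗ/(2R⁴) (R^{|α|} + (−R)^{|α|}) xₗ^α = y_α + 1_{|α|=4} Σₗ cₗ xₗ^α`. [folklore] -/
theorem surgery_moment {n M : ℕ} (y : (Fin n →₀ ℕ) → ℝ) (hy0 : y 0 = 1)
    (c : Fin M → ℝ) (xv : Fin M → Fin n → ℝ) {R : ℝ} (hR : R ≠ 0)
    (hw : (∑ l, c l) / R ^ 4 ≠ 1) {α : Fin n →₀ ℕ} (hα : α.degree ≤ 4) :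
    (1 - (∑ l, c l) / R ^ 4) * (if α = 0 then 1 else
        (y α - if α.degree = 2 then (∑ l, c l * ∏ i, xv l i ^ α i) / R ^ 2 else 0) /
          (1 - (∑ l, c l) / R ^ 4)) +
      ∑ l, c l / (2 * R ^ 4) * ((R ^ α.degree + (-R) ^ α.degree) * ∏ i, xv l i ^ α i) =
    y α + if α.degree = 4 then ∑ l, c l * ∏ i, xv l i ^ α i else 0 := by
  have h1w : 1 - (∑ l, c l) / R ^ 4 ≠ 0 := sub_ne_zero.2 (Ne.symm hw)
  have hR4 : R ^ 4 ≠ 0 := pow_ne_zero 4 hR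
  by_cases h0 : α = 0
  · subst h0
    simp only [if_true, map_zero, pow_zero, Finsupp.coe_zero, Pi.zero_apply,
      Finset.prod_const_one, mul_one, show (0 : ℕ) ≠ 4 from by omega, if_false, add_zero, hy0]
    rw [← Finset.sum_mul, ← Finset.sum_div]
    field_simp
    ring
  · have hd0 : α.degree ≠ 0 := fun h => h0 ((Finsupp.degree_eq_zero_iff α).1 h)
    rw [if_neg h0, mul_div_cancel₀ _ h1w]
    obtain hd | hd | hd | hd : α.degree = 1 ∨ α.degree = 2 ∨ α.degree = 3 ∨ α.degree = 4 := by omega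
    · simp [hd]
    · simp only [hd, if_true, show (2 : ℕ) ≠ 4 from by omega, if_false, add_zero]
      have h2 : ∀ l, c l / (2 * R ^ 4) * ((R ^ 2 + (-R) ^ 2) * ∏ i, xv l i ^ α i) =
          (c l * ∏ i, xv l i ^ α i) / R ^ 2 := fun l => by
        field_simp
        ring
      simp_rw [h2]
      rw [← Finset.sum_div]
      ring
    · simp [hd, Odd.neg_pow (by decide : Odd 3)]
    · simp only [hd, if_true, show (4 : ℕ) ≠ 2 from by omega, if_false, sub_zero]
      congr 1
      refine Finset.sum_congr rfl fun l _ => ?_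
      field_simp
      ring

/-- **The far-atom moment identity.** With `w = (Σ cₗ)/R⁴ ≠ 1` and the modified sequence
`y'` (`y'_0 = 1`, `y'_α = [y_α − 1_{|α|=2} R⁻² Σₗ cₗ xₗ^α]/(1 − w)` for `|α| ≥ 1`), every polynomial
`Q` of total degree `≤ 4` satisfies
`(1 − w) L_{y'}(Q) + Σₗ cₗ/(2R⁴) (Q(R xₗ) + Q(−R xₗ)) = L_y(Q) + Σₗ cₗ Q₄(xₗ)`, `Q₄` the
degree-`4` homogeneous component: the even far atoms restore the second moments, leave the odd
moments alone and add `Σ cₗ xₗ^{⊗4}` to the fourth. [folklore] -/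
theorem surgery_rieszFunctional {n M : ℕ} (y : (Fin n →₀ ℕ) → ℝ) (hy0 : y 0 = 1)
    (c : Fin M → ℝ) (xv : Fin M → Fin n → ℝ) {R : ℝ} (hR : R ≠ 0)
    (hw : (∑ l, c l) / R ^ 4 ≠ 1) (Q : MvPolynomial (Fin n) ℝ) (hQ : Q.totalDegree ≤ 4) :
    (1 - (∑ l, c l) / R ^ 4) * rieszFunctional (fun α => if α = 0 then 1 else
        (y α - if α.degree = 2 then (∑ l, c l * ∏ i, xv l i ^ α i) / R ^ 2 else 0) /
          (1 - (∑ l, c l) / R ^ 4)) Q +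
      ∑ l, c l / (2 * R ^ 4) * (eval (R • xv l) Q + eval (-R • xv l) Q) =
    rieszFunctional y Q + ∑ l, c l * eval (xv l) (homogeneousComponent 4 Q) := by
  classical
  have hdegα : ∀ α ∈ Q.support, α.degree ≤ 4 := fun α hα =>
    (finsupp_degree_eq_sum α).trans_le ((le_totalDegree hα).trans hQ)
  -- all four terms as sums over the support of `Q`
  have hev : ∀ (t : ℝ) (l : Fin M), eval (t • xv l) Q =
      ∑ α ∈ Q.support, Q.coeff α * (t ^ α.degree * ∏ i, xv l i ^ α i) := fun t l => by
    rw [eval_eq']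
    refine Finset.sum_congr rfl fun α _ => ?_
    rw [← prod_mul_pow_eq]
    rfl
  have hev4 : ∀ l : Fin M, eval (xv l) (homogeneousComponent 4 Q) =
      ∑ α ∈ Q.support, Q.coeff α * if α.degree = 4 then ∏ i, xv l i ^ α i else 0 := fun l => by
    rw [eval_eq', support_homogeneousComponent, Finset.sum_filter]
    refine Finset.sum_congr rfl fun α _ => ?_
    split_ifs with h
    · rw [coeff_homogeneousComponent, if_pos h]
    · rw [mul_zero]
  unfold rieszFunctional
  simp_rw [hev, hev4]
  -- both sides as one sum over the support
  have hL : (1 - (∑ l, c l) / R ^ 4) * ∑ α ∈ Q.support, Q.coeff α * (if α = 0 then 1 else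
        (y α - if α.degree = 2 then (∑ l, c l * ∏ i, xv l i ^ α i) / R ^ 2 else 0) /
          (1 - (∑ l, c l) / R ^ 4)) +
      ∑ l, c l / (2 * R ^ 4) *
        ((∑ α ∈ Q.support, Q.coeff α * (R ^ α.degree * ∏ i, xv l i ^ α i)) +
          ∑ α ∈ Q.support, Q.coeff α * ((-R) ^ α.degree * ∏ i, xv l i ^ α i)) =
      ∑ α ∈ Q.support, Q.coeff α * ((1 - (∑ l, c l) / R ^ 4) * (if α = 0 then 1 else
        (y α - if α.degree = 2 then (∑ l, c l * ∏ i, xv l i ^ α i) / R ^ 2 else 0) /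
          (1 - (∑ l, c l) / R ^ 4)) +
        ∑ l, c l / (2 * R ^ 4) * ((R ^ α.degree + (-R) ^ α.degree) * ∏ i, xv l i ^ α i)) := by
    have h2 : ∀ l, c l / (2 * R ^ 4) *
        ((∑ α ∈ Q.support, Q.coeff α * (R ^ α.degree * ∏ i, xv l i ^ α i)) +
          ∑ α ∈ Q.support, Q.coeff α * ((-R) ^ α.degree * ∏ i, xv l i ^ α i)) =
        ∑ α ∈ Q.support, c l / (2 * R ^ 4) *
          (Q.coeff α * ((R ^ α.degree + (-R) ^ α.degree) * ∏ i, xv l i ^ α i)) := fun l => by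
      rw [← Finset.sum_add_distrib, Finset.mul_sum]
      exact Finset.sum_congr rfl fun α _ => by ring
    simp_rw [h2]
    rw [Finset.mul_sum, Finset.sum_comm, ← Finset.sum_add_distrib]
    refine Finset.sum_congr rfl fun α _ => ?_
    rw [mul_add, Finset.mul_sum]
    congr 1
    · ring
    · exact Finset.sum_congr rfl fun l _ => by ring
  have hRt : (∑ α ∈ Q.support, Q.coeff α * y α) +
      ∑ l, c l * ∑ α ∈ Q.support, Q.coeff α * (if α.degree = 4 then ∏ i, xv l i ^ α i else 0) =
      ∑ α ∈ Q.support, Q.coeff α *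
        (y α + if α.degree = 4 then ∑ l, c l * ∏ i, xv l i ^ α i else 0) := by
    simp_rw [Finset.mul_sum]
    rw [Finset.sum_comm, ← Finset.sum_add_distrib]
    refine Finset.sum_congr rfl fun α _ => ?_
    rw [mul_add]
    congr 1
    split_ifs with h
    · rw [Finset.mul_sum]
      exact Finset.sum_congr rfl fun l _ => by ring
    · simp
  rw [hL, hRt]
  exact Finset.sum_congr rfl fun α hα => by rw [surgery_moment y hy0 c xv hR hw (hdegα α hα)]

/-! ## Choice of the radius -/

/-- **For `R → ∞` the modified sequence is close to `y`.** Given `ε > 0` there is `R ≥ 1` with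
`|w| = |(Σ cₗ)/R⁴| ≤ 1/2` and `|y'_α − y_α| ≤ ε` for all `|α| ≤ 4`. [folklore] -/
theorem exists_surgery_radius {n M : ℕ} (y : (Fin n →₀ ℕ) → ℝ) (hy0 : y 0 = 1)
    (c : Fin M → ℝ) (xv : Fin M → Fin n → ℝ) {ε : ℝ} (hε : 0 < ε) :
    ∃ R : ℝ, 1 ≤ R ∧ |(∑ l, c l) / R ^ 4| ≤ 1 / 2 ∧ ∀ α : Fin n →₀ ℕ, α.degree ≤ 4 →
      |(if α = 0 then 1 else
          (y α - if α.degree = 2 then (∑ l, c l * ∏ i, xv l i ^ α i) / R ^ 2 else 0) /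
            (1 - (∑ l, c l) / R ^ 4)) - y α| ≤ ε := by
  classical
  obtain ⟨T, hT⟩ := exists_finset_degree_le n 4
  have hinv2 : Tendsto (fun R : ℝ => (R ^ 2)⁻¹) atTop (𝓝 0) :=
    tendsto_inv_atTop_zero.comp (tendsto_pow_atTop two_ne_zero)
  have hinv4 : Tendsto (fun R : ℝ => (R ^ 4)⁻¹) atTop (𝓝 0) :=
    tendsto_inv_atTop_zero.comp (tendsto_pow_atTop (by norm_num))
  have hw : Tendsto (fun R : ℝ => (∑ l, c l) / R ^ 4) atTop (𝓝 0) := by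
    simpa [div_eq_mul_inv] using (tendsto_const_nhds (x := ∑ l, c l)).mul hinv4
  have hden : Tendsto (fun R : ℝ => 1 - (∑ l, c l) / R ^ 4) atTop (𝓝 1) := by
    simpa using (tendsto_const_nhds (x := (1 : ℝ))).sub hw
  -- each entry converges to `y α`
  have hα : ∀ α : Fin n →₀ ℕ, Tendsto (fun R : ℝ => (if α = 0 then 1 else
      (y α - if α.degree = 2 then (∑ l, c l * ∏ i, xv l i ^ α i) / R ^ 2 else 0) /
        (1 - (∑ l, c l) / R ^ 4)) - y α) atTop (𝓝 0) := by
    intro α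
    by_cases h0 : α = 0
    · subst h0
      simp only [if_true, hy0, sub_self]
      exact tendsto_const_nhds
    · simp only [if_neg h0]
      have hnum : Tendsto (fun R : ℝ => y α -
          if α.degree = 2 then (∑ l, c l * ∏ i, xv l i ^ α i) / R ^ 2 else 0) atTop (𝓝 (y α)) := by
        by_cases h2 : α.degree = 2
        · simp only [if_pos h2]
          have h : Tendsto (fun R : ℝ => (∑ l, c l * ∏ i, xv l i ^ α i) / R ^ 2) atTop (𝓝 0) := by
            simpa [div_eq_mul_inv] using
              (tendsto_const_nhds (x := ∑ l, c l * ∏ i, xv l i ^ α i)).mul hinv2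
          simpa using (tendsto_const_nhds (x := y α)).sub h
        · simp only [if_neg h2, sub_zero]
          exact tendsto_const_nhds
      have h := (hnum.div hden one_ne_zero).sub (tendsto_const_nhds (x := y α))
      rw [div_one, sub_self] at h
      exact h
  -- eventually all requirements hold
  have hev1 : ∀ᶠ R : ℝ in atTop, 1 ≤ R := eventually_ge_atTop 1
  have hev2 : ∀ᶠ R : ℝ in atTop, |(∑ l, c l) / R ^ 4| ≤ 1 / 2 := by
    filter_upwards [Metric.tendsto_nhds.1 hw (1 / 2) (by norm_num)] with R hR
    rw [Real.dist_0_eq_abs] at hR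
    exact hR.le
  have hev3 : ∀ᶠ R : ℝ in atTop, ∀ α ∈ T, |(if α = 0 then 1 else
      (y α - if α.degree = 2 then (∑ l, c l * ∏ i, xv l i ^ α i) / R ^ 2 else 0) /
        (1 - (∑ l, c l) / R ^ 4)) - y α| ≤ ε := by
    refine (eventually_all_finset T).2 fun α _ => ?_
    filter_upwards [Metric.tendsto_nhds.1 (hα α) ε hε] with R hR
    rw [Real.dist_0_eq_abs] at hR
    exact hR.le
  obtain ⟨R, h1, h2, h3⟩ := (hev1.and (hev2.and hev3)).exists
  refine ⟨R, h1, h2, fun α hαd => h3 α ((hT α).2 ?_)⟩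
  rw [← finsupp_degree_eq_sum]
  exact hαd

end Summit.AnomalousDissipation.AnomalousDissipation.Theorems.MomentParityQuarticGate
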